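import Summits.BirchSwinnertonDyer.BirchSwinnertonDyer.Theorems.SignedLowerHalvesSmallImageLowerHalfBothSignsRttD2J2DeltaLevelMap
import Summits.BirchSwinnertonDyer.BirchSwinnertonDyer.Theorems.SignedLowerHalvesSmallImageLowerHalfBothSignsRttD2TwistSemilinear
import HarnessLib

/-!
# Route `SignedLowerHalves`, crux L `SmallImageLowerHalfBothSigns` (stmt-BirchSwinnertonDyer-23599), line `rtt_w3` v15 — E2, junction row J2,
# research half «δ₁», brick (δ-e): ASSEMBLY OF THE CONNECTING MAP `δ₁ : 𝐇¹_cyc → 𝐇²₂[T₂]` ON THE PINNED DATA AND ITS `Λ_𝒪`-SEMILINEARITY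

INPUTS hand `bsd-inputs-honda-p1` g24 under LEAD `cruxlead-stmt-BirchSwinnertonDyer-23599` g11 (v15.1, stub B `stub_charRoadJunction_ns`, row J2; J2 socket p786107). For
`D₂ : IwasawaCohomologyDataO S κ₁ κ₂ γ₁ γ₂ θ 𝔣 2` and `I : CycIwasawaCohomologyDataO S κ₁ γ₁ θ (suppPF p 𝔣) 1` (ANY pinned data) the level maps `dLevel` of brick (δ-d3) applied to
the components of `x ∈ I.H` form a compatible family (`isCompatibleFamilyO_deltaFamily`), hence ((P3)/(P4) of `D₂`) a unique element of `D₂.H`: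
* ★★★ `deltaHom … D₂ I : I.H →+ D₂.H`, `proj_deltaHom(_eq)` (its level-`(n,k)` component is `d_{n,k,m} (I.proj m k x)` for every `m ≥ n + k`);
* `C_X_smul_deltaHom` (`T₂ • δ x = 0`: the image lies in `D₂.H[T₂]`, (L2) + (P6)); `deltaHom_X_smul` (`δ (T • x) = T₁ • δ x`, (L7) at `γ₁` + (P5)); `deltaHom_C_smul`
  (`δ (c • x) = c • δ x`, (L6) + (P7));
* ★★★ `deltaHom_smul` — FULL SEMILINEARITY `δ (l • x) = ι(l) • δ x` along `ι = PowerSeries.map C : Λ_𝒪 → Λ_{𝒪,2}` for EVERY power series `l` (polynomials by the two laws;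
  tails `X^N l'` vanish at each level for `N` beyond the pointwise nilpotence exponents of `conj_{γ₁} − 1`, by (P8));
* ★ `deltaTors … : I.H →+ torsionBy Λ_{𝒪,2} D₂.H (C (X − C 0))` with `deltaTors_smul` — EXACTLY the binders `δ₁`, `hδ₁` of the J2 socket at `b = 0`.
DEFINITIONS WITH BODIES + THEOREMS (`--supports stmt-BirchSwinnertonDyer-23599` helper); no named fact, no `sorry`; crux L, crux M, E2 and BSD remain OPEN and are proved for NO curve.
References: [PerrinRiou1994Invent] §1.3; [JohnsonLeungKings2011] §4.2 Def. 4.2 (94), Lemma 4.4; [Lang1990] Ch. 5 §1; [SerreGaloisCohomology1997] I §2.2–§2.5.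
-/

set_option autoImplicit false
-- the Theorems namespace of this sub repeats the summit name by design (D-0017 nested layout)
set_option linter.dupNamespace false

noncomputable section

open scoped NumberField
open Field IsDedekindDomain
open Literature.NumberTheory.GaloisRepresentations
open Literature.NumberTheory.EllipticCurves
open Literature.NumberTheory.ComplexMultiplication.EllipticUnits
open Literature.NumberTheory.ComplexMultiplication.EllipticUnits.JohnsonLeungKings2011
open Summit.BirchSwinnertonDyer.BirchSwinnertonDyer.Theorems.SmallImageRttD2J1
open Summit.BirchSwinnertonDyer.BirchSwinnertonDyer.Theorems.SmallImageRttD2J2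

namespace Summit.BirchSwinnertonDyer.BirchSwinnertonDyer.Theorems.SmallImageRttD2J2Delta

/-- Powers beyond a killing exponent still kill. [folklore] -/
theorem pow_apply_eq_zero_of_le {M : Type*} [AddCommGroup M] (E : AddMonoid.End M) {N₀ N : ℕ} (h : N₀ ≤ N) (c : M) (hc : (E ^ N₀) c = 0) :
    (E ^ N) c = 0 := by
  obtain ⟨j, rfl⟩ := Nat.exists_eq_add_of_le h
  rw [add_comm, pow_add, AddMonoid.End.coe_mul, Function.comp_apply, hc, map_zero]

variable {K : Type} [Field K] [NumberField K] {p : ℕ} [Fact p.Prime] (S : Set (PadicAlgCl p)) [FiniteDimensional ℚ_[p] (padicCoeffField S)]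
  (κ₁ κ₂ : ZpExtension K p) {γ₁ γ₂ : absoluteGaloisGroup K} (θ : absoluteGaloisGroup K →ₜ* (padicCoeffIntegers S)ˣ) (𝔣 : Ideal (𝓞 K))
  (hγ₁ : γ₂ ∈ κ₁.kerSubgroup) (hγu : IsUnit (κ₂ γ₂).toAdd) (hV : ∀ m : ℕ, ramificationSubgroup K (suppPF p 𝔣) ≤ JohnsonLeungKings2011.pairLayerSubgroup κ₁ κ₂ m)
  (D₂ : IwasawaCohomologyDataO S κ₁ κ₂ γ₁ γ₂ θ 𝔣 2) (I : CycIwasawaCohomologyDataO S κ₁ γ₁ θ (suppPF p 𝔣) 1)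

include hγ₁ hγu hV

/-! ## §1 The compatible family and the assembled map -/

/-- **Level raising**: `d_{n,k,m} (proj_{m,k} x) = d_{n,k,m'} (proj_{m',k} x)` for `m ≤ m'` ((L4) + (P1) of `I`). [cite: NeukirchSchmidtWingberg2008, (1.3.3)] -/
theorem dLevel_proj_eq (x : I.H) (k : ℕ) {n m m' : ℕ} (h : n + k ≤ m) (h' : n + k ≤ m') (hle : m ≤ m') :
    dLevel S κ₁ κ₂ θ 𝔣 hγ₁ hγu hV k h (I.proj m k x) = dLevel S κ₁ κ₂ θ 𝔣 hγ₁ hγu hV k h' (I.proj m' k x) := by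
  obtain ⟨j, rfl⟩ := Nat.exists_eq_add_of_le hle
  induction j with
  | zero => rfl
  | succ j ih =>
    have h1 : n + k ≤ m + j := le_trans h (Nat.le_add_right m j)
    rw [ih h1 (Nat.le_add_right m j), ← I.proj_cores (m + j) k x]
    exact dLevel_cycLayerCoresO S κ₁ κ₂ θ 𝔣 hγ₁ hγu hV k h1 h' _

/-- The family of level images `d_{n,k,n+k} (proj_{n+k,k} x)`. [cite: PerrinRiou1994Invent, §1.3] -/
def deltaFamily (x : I.H) (n k : ℕ) : layerCohO S κ₁ κ₂ θ 𝔣 n k 2 :=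
  dLevel S κ₁ κ₂ θ 𝔣 hγ₁ hγu hV k le_rfl (I.proj (n + k) k x)

/-- ★ **The family is compatible** under `cor` in `n` ((L3) + level raising) and the reductions in `k` ((L5) + (P2) of `I` + level raising).
[cite: JohnsonLeungKings2011, Def. 4.2 (94) (arXiv p0012:L94)] [cite: Kato2004Asterisque, §8.2 (p. 180)] -/
theorem isCompatibleFamilyO_deltaFamily (x : I.H) : IsCompatibleFamilyO S κ₁ κ₂ θ 𝔣 2 (deltaFamily S κ₁ κ₂ θ 𝔣 hγ₁ hγu hV I x) := by
  refine ⟨fun n k ↦ ?_, fun n k ↦ ?_⟩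
  · rw [deltaFamily, deltaFamily, layerCoresO_dLevel S κ₁ κ₂ θ 𝔣 hγ₁ hγu hV k le_rfl (by omega)]
    exact (dLevel_proj_eq S κ₁ κ₂ θ 𝔣 hγ₁ hγu hV I x k le_rfl (by omega) (by omega)).symm
  · rw [deltaFamily, deltaFamily, layerRedO_dLevel S κ₁ κ₂ θ 𝔣 hγ₁ hγu hV k le_rfl (by omega), I.proj_red]
    exact (dLevel_proj_eq S κ₁ κ₂ θ 𝔣 hγ₁ hγu hV I x k le_rfl (by omega) (by omega)).symm

/-- Through (P3)/(P4) of `D₂`: the family IS a unique element of `D₂.H`. [cite: JohnsonLeungKings2011, Def. 4.2 (94) (arXiv p0012:L94)] -/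
theorem existsUnique_delta (x : I.H) : ∃! z : D₂.H, ∀ n k, D₂.proj n k z = deltaFamily S κ₁ κ₂ θ 𝔣 hγ₁ hγu hV I x n k :=
  D₂.exists_unique_of_isCompatibleFamilyO (isCompatibleFamilyO_deltaFamily S κ₁ κ₂ θ 𝔣 hγ₁ hγu hV I x)

/-- ★★★ **THE CONNECTING MAP `δ : 𝐇¹_P(K^{(1)}_∞, 𝒪(θ)(1)) → 𝐇²(𝒪_K[1/p𝔣], Λ_𝒪(θ)(1))` on the pinned data** (additive by uniqueness).
[cite: PerrinRiou1994Invent, §1.3] [cite: JohnsonLeungKings2011, §4.2, Lemma 4.4] -/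
def deltaHom : I.H →+ D₂.H where
  toFun x := (existsUnique_delta S κ₁ κ₂ θ 𝔣 hγ₁ hγu hV D₂ I x).exists.choose
  map_zero' := by
    refine (existsUnique_delta S κ₁ κ₂ θ 𝔣 hγ₁ hγu hV D₂ I 0).unique (existsUnique_delta S κ₁ κ₂ θ 𝔣 hγ₁ hγu hV D₂ I 0).exists.choose_spec fun n k ↦ ?_
    simp only [deltaFamily, map_zero]
  map_add' x y := by
    refine (existsUnique_delta S κ₁ κ₂ θ 𝔣 hγ₁ hγu hV D₂ I (x + y)).unique
      (existsUnique_delta S κ₁ κ₂ θ 𝔣 hγ₁ hγu hV D₂ I (x + y)).exists.choose_spec fun n k ↦ ?_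
    rw [map_add, (existsUnique_delta S κ₁ κ₂ θ 𝔣 hγ₁ hγu hV D₂ I x).exists.choose_spec,
      (existsUnique_delta S κ₁ κ₂ θ 𝔣 hγ₁ hγu hV D₂ I y).exists.choose_spec]
    simp only [deltaFamily, map_add]

/-- The level components of `δ x`: `proj_{n,k} (δ x) = d_{n,k,n+k} (proj_{n+k,k} x)`. [cite: PerrinRiou1994Invent, §1.3] -/
theorem proj_deltaHom (x : I.H) (n k : ℕ) :
    D₂.proj n k (deltaHom S κ₁ κ₂ θ 𝔣 hγ₁ hγu hV D₂ I x) = dLevel S κ₁ κ₂ θ 𝔣 hγ₁ hγu hV k le_rfl (I.proj (n + k) k x) :=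
  (existsUnique_delta S κ₁ κ₂ θ 𝔣 hγ₁ hγu hV D₂ I x).exists.choose_spec n k

/-- The level components at ANY source level `m ≥ n + k`. [cite: PerrinRiou1994Invent, §1.3] -/
theorem proj_deltaHom_eq (x : I.H) (n k : ℕ) {m : ℕ} (h : n + k ≤ m) :
    D₂.proj n k (deltaHom S κ₁ κ₂ θ 𝔣 hγ₁ hγu hV D₂ I x) = dLevel S κ₁ κ₂ θ 𝔣 hγ₁ hγu hV k h (I.proj m k x) := by
  rw [proj_deltaHom]
  exact dLevel_proj_eq S κ₁ κ₂ θ 𝔣 hγ₁ hγu hV I x k le_rfl h h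

/-! ## §2 The three elementary laws -/

/-- ★ **`T₂ • δ x = 0`**: the image of `δ` is killed by `C X = T₂ ↦ conj_{γ₂} − 1` ((P6) + (L2)). [cite: PerrinRiou1994Invent, §1.3] -/
theorem C_X_smul_deltaHom (x : I.H) :
    (PowerSeries.C (PowerSeries.X : PowerSeries (padicCoeffIntegers S)) : IwasawaAlgebraO₂ S) • deltaHom S κ₁ κ₂ θ 𝔣 hγ₁ hγu hV D₂ I x = 0 :=
  D₂.proj_injective _ fun n k ↦ by
    rw [D₂.proj_T₂_smul, proj_deltaHom, layerConjO_dLevel_self, sub_self]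

/-- ★ **`δ (T • x) = T₁ • δ x`** ((P5) of `I` and of `D₂`, (L7) at `γ₁`). [cite: JohnsonLeungKings2011, §4.2 (arXiv p0012:L109–112)] -/
theorem deltaHom_X_smul (x : I.H) :
    deltaHom S κ₁ κ₂ θ 𝔣 hγ₁ hγu hV D₂ I ((PowerSeries.X : IwasawaAlgebraO S) • x) =
      (PowerSeries.X : IwasawaAlgebraO₂ S) • deltaHom S κ₁ κ₂ θ 𝔣 hγ₁ hγu hV D₂ I x :=
  sub_eq_zero.mp (D₂.proj_injective _ fun n k ↦ by
    rw [map_sub, proj_deltaHom, I.proj_X_smul, map_sub, ← layerConjO_dLevel, D₂.proj_T₁_smul, proj_deltaHom, sub_self])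

/-- ★ **`δ (c • x) = c • δ x`** for the constants ((P7) of `I` and of `D₂`, (L6)). [cite: JohnsonLeungKings2011, §4.1 Def. 4.1 (arXiv p0012:L59–60)] -/
theorem deltaHom_C_smul (c : padicCoeffIntegers S) (x : I.H) :
    deltaHom S κ₁ κ₂ θ 𝔣 hγ₁ hγu hV D₂ I ((PowerSeries.C c : IwasawaAlgebraO S) • x) =
      (PowerSeries.C (PowerSeries.C c : PowerSeries (padicCoeffIntegers S)) : IwasawaAlgebraO₂ S) • deltaHom S κ₁ κ₂ θ 𝔣 hγ₁ hγu hV D₂ I x :=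
  sub_eq_zero.mp (D₂.proj_injective _ fun n k ↦ by
    rw [map_sub, proj_deltaHom, I.proj_C_smul, ← layerScalarO_dLevel, D₂.proj_C_smul, proj_deltaHom, sub_self])

/-- `δ (T^N • x) = T₁^N • δ x`. [cite: JohnsonLeungKings2011, §4.2] -/
theorem deltaHom_X_pow_smul (N : ℕ) (x : I.H) :
    deltaHom S κ₁ κ₂ θ 𝔣 hγ₁ hγu hV D₂ I ((PowerSeries.X : IwasawaAlgebraO S) ^ N • x) =
      (PowerSeries.X : IwasawaAlgebraO₂ S) ^ N • deltaHom S κ₁ κ₂ θ 𝔣 hγ₁ hγu hV D₂ I x := by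
  induction N with
  | zero => rw [pow_zero, pow_zero, one_smul, one_smul]
  | succ N ih => rw [pow_succ', mul_smul, deltaHom_X_smul, ih, pow_succ', mul_smul]

/-- `δ` matches `ι = PowerSeries.map C` on monomials `C c * T^N`. [cite: JohnsonLeungKings2011, §4.1–§4.2] -/
theorem deltaHom_monomial_smul (c : padicCoeffIntegers S) (N : ℕ) (x : I.H) :
    deltaHom S κ₁ κ₂ θ 𝔣 hγ₁ hγu hV D₂ I ((PowerSeries.C c * PowerSeries.X ^ N : IwasawaAlgebraO S) • x) =
      (PowerSeries.map (PowerSeries.C : padicCoeffIntegers S →+* IwasawaAlgebraO S) (PowerSeries.C c * PowerSeries.X ^ N)) •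
        deltaHom S κ₁ κ₂ θ 𝔣 hγ₁ hγu hV D₂ I x := by
  rw [mul_smul, deltaHom_C_smul, deltaHom_X_pow_smul, map_mul, map_pow, PowerSeries.map_C, PowerSeries.map_X, mul_smul]

/-! ## §3 Full semilinearity -/

omit [FiniteDimensional ℚ_[p] (padicCoeffField S)] hγ₁ hγu hV in
/-- `I.proj n k (T^N • y) = (conj_{γ₁} − 1)^N (I.proj n k y)`. [cite: JohnsonLeungKings2011, §4.2 (arXiv p0012:L109–112)] -/
theorem cyc_proj_X_pow_smul (n k N : ℕ) (y : I.H) :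
    I.proj n k ((PowerSeries.X : IwasawaAlgebraO S) ^ N • y) = ((cycLayerConjEndO S κ₁ θ (suppPF p 𝔣) n k 1 γ₁ - 1) ^ N) (I.proj n k y) := by
  induction N generalizing y with
  | zero => rw [pow_zero, one_smul, pow_zero]; rfl
  | succ N ih =>
    rw [pow_succ, mul_smul, ih, I.proj_X_smul, pow_succ, AddMonoid.End.coe_mul, Function.comp_apply]
    rfl

omit [FiniteDimensional ℚ_[p] (padicCoeffField S)] hγ₁ hγu hV in
/-- `D₂.proj n k (T₁^N • z) = (conj_{γ₁} − 1)^N (D₂.proj n k z)`. [cite: JohnsonLeungKings2011, §4.2 (arXiv p0012:L109–112)] -/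
theorem pair_proj_X_pow_smul (n k N : ℕ) (z : D₂.H) :
    D₂.proj n k ((PowerSeries.X : IwasawaAlgebraO₂ S) ^ N • z) = ((layerConjEndO S κ₁ κ₂ θ 𝔣 n k 2 γ₁ - 1) ^ N) (D₂.proj n k z) := by
  induction N generalizing z with
  | zero => rw [pow_zero, one_smul, pow_zero]; rfl
  | succ N ih =>
    rw [pow_succ, mul_smul, ih, D₂.proj_T₁_smul, pow_succ, AddMonoid.End.coe_mul, Function.comp_apply]
    rfl

/-- ★★★ **FULL `Λ_𝒪`-SEMILINEARITY**: `δ (l • x) = (PowerSeries.map C l) • δ x` for every `l ∈ Λ_𝒪 = 𝒪⟦T⟧` — the binder `hδ₁` of the J2 socket.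
[cite: JohnsonLeungKings2011, §4.1–§4.2 (arXiv p0012:L59–60, L109–112)] [cite: Lang1990, Ch. 5 §1] -/
theorem deltaHom_smul (l : IwasawaAlgebraO S) (x : I.H) :
    deltaHom S κ₁ κ₂ θ 𝔣 hγ₁ hγu hV D₂ I (l • x) =
      (PowerSeries.map (PowerSeries.C : padicCoeffIntegers S →+* IwasawaAlgebraO S) l) • deltaHom S κ₁ κ₂ θ 𝔣 hγ₁ hγu hV D₂ I x := by
  set δ := deltaHom S κ₁ κ₂ θ 𝔣 hγ₁ hγu hV D₂ I with hδ
  set ι := (PowerSeries.map (PowerSeries.C : padicCoeffIntegers S →+* IwasawaAlgebraO S)) with hι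
  refine sub_eq_zero.mp (D₂.proj_injective _ fun n k ↦ ?_)
  -- killing exponents at the source level `n + k` and the target level `(n, k)`
  obtain ⟨N₁, hN₁⟩ := exists_pow_cycLayerConjEndO_sub_one_apply_eq_zero S κ₁ γ₁ θ (suppPF p 𝔣) (n + k) k (by norm_num : 1 ≤ 2) (I.proj (n + k) k x)
  have hloc := isLocNil₂_layerConjEndO (p := p) S κ₁ κ₂ γ₁ γ₂ θ 𝔣 n k (le_refl 2)
  obtain ⟨N₂, hN₂⟩ := hloc.nil₁ (D₂.proj n k (δ x))
  set N := max N₁ N₂ with hN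
  -- split `l = q + X^N * l'`
  obtain ⟨l', hl'⟩ := SmallImageRttD2Twist.X_pow_dvd_sub_sum_range N l
  set q : IwasawaAlgebraO S := ∑ j ∈ Finset.range N, PowerSeries.C (PowerSeries.coeff j l) * PowerSeries.X ^ j with hq
  have hl : l = q + PowerSeries.X ^ N * l' := by rw [← hl']; abel
  -- polynomials: `δ (q • x) = ι q • δ x`
  have hpoly : δ (q • x) = ι q • δ x := by
    rw [hq, Finset.sum_smul, map_sum, map_sum, Finset.sum_smul]
    exact Finset.sum_congr rfl fun j _ ↦ deltaHom_monomial_smul S κ₁ κ₂ θ 𝔣 hγ₁ hγu hV D₂ I _ j x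
  -- tails vanish at level `(n, k)`
  have htail₁ : D₂.proj n k (δ ((PowerSeries.X ^ N * l') • x)) = 0 := by
    rw [mul_comm, mul_smul, hδ, proj_deltaHom]
    have h0 : I.proj (n + k) k ((PowerSeries.X : IwasawaAlgebraO S) ^ N • x) = 0 := by
      rw [cyc_proj_X_pow_smul]
      exact pow_apply_eq_zero_of_le _ (le_max_left N₁ N₂) _ hN₁
    rw [I.proj_smul_eq_zero _ _ l' _ h0, map_zero]
  have htail₂ : D₂.proj n k (ι (PowerSeries.X ^ N * l') • δ x) = 0 := by
    rw [map_mul, map_pow, hι, PowerSeries.map_X, mul_comm, mul_smul]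
    have h0 : D₂.proj n k ((PowerSeries.X : IwasawaAlgebraO₂ S) ^ N • δ x) = 0 := by
      rw [pair_proj_X_pow_smul]
      exact pow_apply_eq_zero_of_le _ (le_max_right N₁ N₂) _ hN₂
    exact D₂.proj_smul_eq_zero _ _ _ _ h0
  rw [map_sub, hl, add_smul, map_add, map_add, map_add, add_smul, map_add, hpoly, htail₁, htail₂, add_zero]
  simp

/-! ## §4 The packaged map into `D₂.H[T₂]` (the socket's `δ₁`, `hδ₁` at `b = 0`) -/

/-- ★ **`δ₁ : I.H →+ D₂.H[C (X − C 0)]`** (the J2 socket's codomain at `b = 0`; `C (X − C 0) = C X`). [cite: PerrinRiou1994Invent, §1.3] -/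
def deltaTors : I.H →+ Submodule.torsionBy (IwasawaAlgebraO₂ S) D₂.H
    (PowerSeries.C (PowerSeries.X - PowerSeries.C (0 : padicCoeffIntegers S) : PowerSeries (padicCoeffIntegers S)) : IwasawaAlgebraO₂ S) where
  toFun x := ⟨deltaHom S κ₁ κ₂ θ 𝔣 hγ₁ hγu hV D₂ I x, by
    rw [Submodule.mem_torsionBy_iff, map_zero, sub_zero]
    exact C_X_smul_deltaHom S κ₁ κ₂ θ 𝔣 hγ₁ hγu hV D₂ I x⟩
  map_zero' := Subtype.ext (map_zero _)
  map_add' x y := Subtype.ext (map_add _ x y)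

/-- `deltaTors` on elements. [cite: PerrinRiou1994Invent, §1.3] -/
@[simp] theorem coe_deltaTors (x : I.H) :
    (deltaTors S κ₁ κ₂ θ 𝔣 hγ₁ hγu hV D₂ I x : D₂.H) = deltaHom S κ₁ κ₂ θ 𝔣 hγ₁ hγu hV D₂ I x := rfl

/-- ★ **`hδ₁` of the J2 socket**: `δ₁ (l • x) = (PowerSeries.map C l) • δ₁ x`. [cite: JohnsonLeungKings2011, §4.1–§4.2] -/
theorem deltaTors_smul (l : IwasawaAlgebraO S) (x : I.H) :
    deltaTors S κ₁ κ₂ θ 𝔣 hγ₁ hγu hV D₂ I (l • x) =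
      (PowerSeries.map (PowerSeries.C : padicCoeffIntegers S →+* IwasawaAlgebraO S) l) • deltaTors S κ₁ κ₂ θ 𝔣 hγ₁ hγu hV D₂ I x :=
  Subtype.ext (deltaHom_smul S κ₁ κ₂ θ 𝔣 hγ₁ hγu hV D₂ I l x)

/-- `deltaTors x = 0 ↔ deltaHom x = 0`. [folklore] -/
theorem deltaTors_eq_zero_iff (x : I.H) : deltaTors S κ₁ κ₂ θ 𝔣 hγ₁ hγu hV D₂ I x = 0 ↔ deltaHom S κ₁ κ₂ θ 𝔣 hγ₁ hγu hV D₂ I x = 0 := by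
  rw [← coe_deltaTors, Submodule.coe_eq_zero]

end Summit.BirchSwinnertonDyer.BirchSwinnertonDyer.Theorems.SmallImageRttD2J2Delta

end
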